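import Summits.RiemannHypothesis.RiemannHypothesis.Theorems.MotivicDoorFfSparseWalk

/-!
# Motivic door, function-field side (C)(i), part 7d: SPARSE LAG SETS — one far trace can certify (deciding ≠ matching)
(pub-rhdoor seat ff-1.  HONEST FRAMING: lottery ticket at the motivic door; RH probability negligible; consolation
prizes are real: a new semi-local Weil-positivity theorem, or a located gap in the Connes–Consani programme, plus the
ff-door theorem.  No claim about `ζ`; "RH(q,h)" is `|α| = √q` for the complex roots of ONE integer polynomial `h`.)

Parts 7a–7c: inside the first `g` lags only the full set `{1, …, g}` decides RH at dimension `g`, and BELOW THE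
HANDOVER every sparse trace reader that accepts one honest datum accepts an honest RH-false one
(`MotivicDoorFfSparseThreshold.traceReader_offLag_matched_by_rhFalse`): there, a reader can IMPLY RH only vacuously.
ABOVE THE HANDOVER this fails, already for ONE lag: PROVED here ([folklore] algebra, `g = 2`, lag `3 > g`):

* §1 `powerSum_three_of_dim_two`: for an honest datum of dimension `2` (`q ≥ 1`), `s_3 = -c_3 (c_3^2 - 3 c_2 + 3q)`
  (top-indexed Newton of part 7a at `n = 1, 2, 3`).
* §2 `eq_thinQuartic_of_powerSum_three`: an honest datum of dimension `2` with `s_3 = -1` IS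
  `x^4 + x^3 + q x^2 + q x + q^2` (`c_3 ∣ 1`, and `c_3 = -1` is impossible mod `3`): ONE far trace PINS the datum —
  whereas off any lag `m ≤ g` the honest fibre is infinite (part 7a `sparseFibre_infinite`).
* §3 `ffRH_thinQuartic`: that datum is RH-TRUE for every `q ≥ 1` (`u = α + q/α` solves `u^2 + u = q`, is real with
  `u > -3q`, so `α` and `ᾱ` are the two roots of `x^2 - u x + q`).
* §4 `farLagReader_certifies`: the `{3}`-trace-local reader `[K(3) = K_thin(3)]` ACCEPTS an honest datum of
  dimension `2`, every honest datum of dimension `2` it accepts is RH-true (it IMPLIES RH, non-vacuously), and yet it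
  does NOT DECIDE RH (it rejects the RH-true `x^4 + q^2`); `farLagReader_not_matched`: it is matched by no honest
  fake.  Contrast (7b): no reader of lags inside `[0, 2] ∖ {m}` can do this.

DOOR READING ((i).G, complement).  Deciding and matching part ways above the handover: position cannot make a sparse
reader DECIDE (7b/7c), but a single far trace can CERTIFY RH on a thin (here: one-point) acceptance set, which no
sparse reading below the handover can.  Nothing here is, or implies, a statement about `ζ`.
-/

set_option linter.dupNamespace false

noncomputable section

open Polynomial Finset

open Summit.RiemannHypothesis.RiemannHypothesis.Theorems.PfPersistence.FfAngleTwin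

namespace Summit.RiemannHypothesis.RiemannHypothesis.Theorems.MotivicDoor.FunctionField

/-- The thin quartic `x^4 + x^3 + q x^2 + q x + q^2` (local notation, no definition). -/
local notation "thinQ[" q "]" =>
  (X ^ 4 + X ^ 3 + C ((q : ℕ) : ℤ) * X ^ 2 + C ((q : ℕ) : ℤ) * X + C (((q : ℕ) : ℤ) ^ 2) : ℤ[X])

/-! ## 1. The first three power sums of an honest datum of dimension 2 -/

/-- The pairs `(i, j)` with `i + j = 1`, `i, j ≥ 1`: none. -/
private theorem antidiag_filter_one :
    ((antidiagonal 1).filter (fun a : ℕ × ℕ => 0 < a.1 ∧ 0 < a.2)) = ∅ := by decide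

/-- The pairs `(i, j)` with `i + j = 2`, `i, j ≥ 1`: `(1,1)`. -/
private theorem antidiag_filter_two :
    ((antidiagonal 2).filter (fun a : ℕ × ℕ => 0 < a.1 ∧ 0 < a.2)) = {(1, 1)} := by decide

/-- The pairs `(i, j)` with `i + j = 3`, `i, j ≥ 1`: `(1,2), (2,1)`. -/
private theorem antidiag_filter_three :
    ((antidiagonal 3).filter (fun a : ℕ × ℕ => 0 < a.1 ∧ 0 < a.2)) = {(1, 2), (2, 1)} := by decide

/-- `s_1 = -c_3`, `s_2 = c_3^2 - 2 c_2`, `s_3 = -c_3^3 + 3 c_2 c_3 - 3 c_1` for a monic quartic. [folklore] -/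
theorem powerSum_le_three_of_natDegree_four {h : ℤ[X]} (hh : h.Monic) (hdeg : h.natDegree = 4) :
    powerSum (frobRoots h) 1 = -(h.coeff 3 : ℂ) ∧
    powerSum (frobRoots h) 2 = (h.coeff 3 : ℂ) ^ 2 - 2 * (h.coeff 2 : ℂ) ∧
    powerSum (frobRoots h) 3 =
      -(h.coeff 3 : ℂ) ^ 3 + 3 * (h.coeff 2 : ℂ) * (h.coeff 3 : ℂ) - 3 * (h.coeff 1 : ℂ) := by
  have h1 := powerSum_frobRoots_newton hh (n := 1) le_rfl (by rw [hdeg]; norm_num)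
  have h2 := powerSum_frobRoots_newton hh (n := 2) (by norm_num) (by rw [hdeg]; norm_num)
  have h3 := powerSum_frobRoots_newton hh (n := 3) (by norm_num) (by rw [hdeg]; norm_num)
  rw [hdeg] at h1 h2 h3
  rw [antidiag_filter_one, sum_empty] at h1
  rw [antidiag_filter_two, sum_singleton] at h2
  rw [antidiag_filter_three, sum_pair (by decide)] at h3
  norm_num at h1 h2 h3
  refine ⟨by rw [h1], by rw [h2, h1]; ring, ?_⟩
  rw [h3, h2, h1]; ring

/-- For an HONEST datum of dimension `2` (`q ≥ 1`; FE gives `c_1 = q c_3`): `s_3 = -c_3 (c_3^2 - 3 c_2 + 3 q)`.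
[folklore] -/
theorem powerSum_three_of_dim_two {q : ℕ} (hq : 0 < q) {h : ℤ[X]} (hh : h.Monic) (hdeg : h.natDegree = 2 * 2)
    (hFE : ∀ i j, i + j = 2 * 2 → (q : ℤ) ^ 2 * h.coeff j = (q : ℤ) ^ i * h.coeff i) :
    powerSum (frobRoots h) 3 =
      -((h.coeff 3 : ℂ) * ((h.coeff 3 : ℂ) ^ 2 - 3 * (h.coeff 2 : ℂ) + 3 * (q : ℂ))) := by
  have hc1 : h.coeff 1 = (q : ℤ) * h.coeff 3 := by
    have e := hFE 1 3 (by norm_num)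
    have hq0 : (q : ℤ) ≠ 0 := by exact_mod_cast hq.ne'
    have : (q : ℤ) * ((q : ℤ) * h.coeff 3 - h.coeff 1) = 0 := by linear_combination e
    rcases mul_eq_zero.1 this with h0 | h0
    · exact absurd h0 hq0
    · linear_combination -h0
  rw [(powerSum_le_three_of_natDegree_four hh hdeg).2.2, hc1]
  push_cast
  ring

/-! ## 2. One far trace pins: `s_3 = -1` forces the thin quartic -/

/-- The coefficients of the thin quartic. -/
theorem thinQuartic_coeff (q : ℕ) :
    (thinQ[q]).coeff 0 = (q : ℤ) ^ 2 ∧ (thinQ[q]).coeff 1 = q ∧ (thinQ[q]).coeff 2 = q ∧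
    (thinQ[q]).coeff 3 = 1 ∧ (thinQ[q]).coeff 4 = 1 ∧ ∀ n, 5 ≤ n → (thinQ[q]).coeff n = 0 := by
  simp only [coeff_add, coeff_X_pow, coeff_C_mul, coeff_X, coeff_C]
  refine ⟨by norm_num, by norm_num, by norm_num, by norm_num, by norm_num, fun n hn => ?_⟩
  have h4 : n ≠ 4 := by omega
  have h3 : n ≠ 3 := by omega
  have h2 : n ≠ 2 := by omega
  have h1 : (1 : ℕ) ≠ n := by omega
  have h0 : n ≠ 0 := by omega
  simp [h4, h3, h2, h1, h0]

/-- The thin quartic is honest of dimension `2`. [folklore] -/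
theorem thinQuartic_honest (q : ℕ) :
    (thinQ[q]).Monic ∧ (thinQ[q]).natDegree = 2 * 2 ∧
    ∀ i j, i + j = 2 * 2 → (q : ℤ) ^ 2 * (thinQ[q]).coeff j = (q : ℤ) ^ i * (thinQ[q]).coeff i := by
  obtain ⟨t0, t1, t2, t3, t4, t5⟩ := thinQuartic_coeff q
  have hdeg : (thinQ[q]).natDegree = 4 := by
    refine le_antisymm ?_ (le_natDegree_of_ne_zero (by rw [t4]; exact one_ne_zero))
    exact (natDegree_le_iff_coeff_eq_zero).2 fun N hN => t5 N (by omega)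
  have hmon : (thinQ[q]).Monic := by
    rw [Monic, leadingCoeff, hdeg, t4]
  refine ⟨hmon, hdeg, ?_⟩
  intro i j hij
  have hi : i ≤ 4 := by omega
  obtain rfl : j = 4 - i := by omega
  interval_cases i
  · rw [show (4 : ℕ) - 0 = 4 from rfl, t4, t0]; ring
  · rw [show (4 : ℕ) - 1 = 3 from rfl, t3, t1]; ring
  · rw [show (4 : ℕ) - 2 = 2 from rfl, t2]
  · rw [show (4 : ℕ) - 3 = 1 from rfl, t1, t3]; ring
  · rw [show (4 : ℕ) - 4 = 0 from rfl, t0, t4]; ring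

/-- `s_3` of the thin quartic is `-1` (`q ≥ 1`). [folklore] -/
theorem powerSum_three_thinQuartic {q : ℕ} (hq : 0 < q) : powerSum (frobRoots thinQ[q]) 3 = -1 := by
  obtain ⟨hm, hd, hfe⟩ := thinQuartic_honest q
  obtain ⟨-, -, h2, h3, -⟩ := thinQuartic_coeff q
  rw [powerSum_three_of_dim_two hq hm hd hfe, h2, h3]
  push_cast
  ring

/-- ONE FAR TRACE PINS THE DATUM: an honest datum of dimension `2` (`q ≥ 1`) with `s_3 = -1` is the thin quartic
`x^4 + x^3 + q x^2 + q x + q^2`.  (`c_3 (c_3^2 - 3 c_2 + 3q) = 1` in `ℤ` forces `c_3 = ±1`; `c_3 = -1` gives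
`3 c_2 = 3 q + 2`, impossible; so `c_3 = 1`, `c_2 = q`, and FE fixes `c_1 = q`, `c_0 = q^2`.)  Contrast: off any lag
`m ≤ g` the honest fibre is infinite (part 7a). [folklore] -/
theorem eq_thinQuartic_of_powerSum_three {q : ℕ} (hq : 0 < q) {h : ℤ[X]} (hh : h.Monic)
    (hdeg : h.natDegree = 2 * 2) (hFE : ∀ i j, i + j = 2 * 2 → (q : ℤ) ^ 2 * h.coeff j = (q : ℤ) ^ i * h.coeff i)
    (hs : powerSum (frobRoots h) 3 = -1) : h = thinQ[q] := by
  rw [powerSum_three_of_dim_two hq hh hdeg hFE] at hs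
  have hz : h.coeff 3 * (h.coeff 3 ^ 2 - 3 * h.coeff 2 + 3 * (q : ℤ)) = 1 := by
    have : ((h.coeff 3 * (h.coeff 3 ^ 2 - 3 * h.coeff 2 + 3 * (q : ℤ)) : ℤ) : ℂ) = ((1 : ℤ) : ℂ) := by
      push_cast; linear_combination -hs
    exact_mod_cast this
  have hc3 : h.coeff 3 = 1 := by
    rcases Int.eq_one_or_neg_one_of_mul_eq_one hz with h1 | h1
    · exact h1
    · exfalso; rw [h1] at hz; omega
  have hc2 : h.coeff 2 = q := by rw [hc3] at hz; linarith
  have hc4 : h.coeff 4 = 1 := by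
    have := hh.coeff_natDegree; rw [hdeg] at this; exact this
  have hc0 : h.coeff 0 = (q : ℤ) ^ 2 := by
    have e := hFE 0 4 (by norm_num); rw [hc4] at e; linear_combination -e
  have hc1 : h.coeff 1 = q := by
    have e := hFE 1 3 (by norm_num)
    rw [hc3] at e
    have hq0 : (q : ℤ) ≠ 0 := by exact_mod_cast hq.ne'
    have : (q : ℤ) * (h.coeff 1 - q) = 0 := by linear_combination -e
    rcases mul_eq_zero.1 this with h0 | h0
    · exact absurd h0 hq0
    · linear_combination h0
  obtain ⟨t0, t1, t2, t3, t4, -⟩ := thinQuartic_coeff q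
  obtain ⟨-, hd', -⟩ := thinQuartic_honest q
  refine (Polynomial.ext_iff_natDegree_le (n := 4) (by rw [hdeg]) (by rw [hd'])).2 ?_
  intro i hi
  interval_cases i
  · rw [hc0, t0]
  · rw [hc1, t1]
  · rw [hc2, t2]
  · rw [hc3, t3]
  · rw [hc4, t4]

/-! ## 3. The thin quartic is RH-true -/

/-- A complex number whose square is a non-negative real is real. -/
private theorem im_eq_zero_of_sq_eq_ofReal {w : ℂ} {r : ℝ} (hr : 0 ≤ r) (hw : w ^ 2 = (r : ℂ)) : w.im = 0 := by
  have hfac : (w - (Real.sqrt r : ℂ)) * (w + (Real.sqrt r : ℂ)) = 0 := by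
    have hs : ((Real.sqrt r : ℂ)) ^ 2 = (r : ℂ) := by
      rw [← Complex.ofReal_pow, Real.sq_sqrt hr]
    linear_combination hw - hs
  rcases mul_eq_zero.1 hfac with h0 | h0
  · have : w = (Real.sqrt r : ℂ) := by linear_combination h0
    rw [this, Complex.ofReal_im]
  · have : w = -(Real.sqrt r : ℂ) := by linear_combination h0
    rw [this, Complex.neg_im, Complex.ofReal_im, neg_zero]

/-- THE THIN QUARTIC IS RH-TRUE (`q ≥ 1`): every complex root `α` of `x^4 + x^3 + q x^2 + q x + q^2` has `|α| = √q`.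
With `u = α + q/α`: `u^2 + u - q = 0`, so `u` is real and `u > -3q`, whence `u^2 < 4q`; `α` and `ᾱ` both solve
`x^2 - u x + q = 0`, and `α` real would need `u^2 ≥ 4q` — so `α ᾱ = q`. [folklore] -/
theorem ffRH_thinQuartic {q : ℕ} (hq : 1 ≤ q) : ∀ α ∈ frobRoots thinQ[q], ‖α‖ = Real.sqrt q := by
  intro α hα
  have hqR : (1 : ℝ) ≤ q := by exact_mod_cast hq
  obtain ⟨hm, -, -⟩ := thinQuartic_honest q
  have hne : ((thinQ[q]).map (Int.castRingHom ℂ)) ≠ 0 := (hm.map _).ne_zero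
  have hroot : α ^ 4 + α ^ 3 + (q : ℂ) * α ^ 2 + (q : ℂ) * α + (q : ℂ) ^ 2 = 0 := by
    have := (mem_roots hne).1 hα
    simpa [Polynomial.map_add, Polynomial.map_mul, Polynomial.map_pow] using this
  have hα0 : α ≠ 0 := by
    rintro rfl
    have h0 : (q : ℂ) ^ 2 = 0 := by simpa using hroot
    have hq0 : (q : ℂ) ≠ 0 := by exact_mod_cast (by omega : q ≠ 0)
    exact hq0 (pow_eq_zero_iff (n := 2) (by norm_num) |>.1 h0)
  -- `u = α + q/α` solves `u² + u − q = 0`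
  set u : ℂ := α + (q : ℂ) / α with hu
  have hαu : α * u = α ^ 2 + q := by rw [hu]; field_simp
  have hquad : u ^ 2 + u - q = 0 := by
    have : α ^ 2 * (u ^ 2 + u - q) = 0 := by
      have e : α ^ 2 * (u ^ 2 + u - q) = α ^ 4 + α ^ 3 + (q : ℂ) * α ^ 2 + (q : ℂ) * α + (q : ℂ) ^ 2 := by
        rw [hu]; field_simp; ring
      rw [e, hroot]
    rcases mul_eq_zero.1 this with h0 | h0
    · exact absurd (pow_eq_zero_iff (n := 2) (by norm_num) |>.1 h0) hα0
    · exact h0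
  -- `u` is real: `(2u+1)² = 1 + 4q`
  have huim : u.im = 0 := by
    have hw : (2 * u + 1) ^ 2 = ((1 + 4 * (q : ℝ) : ℝ) : ℂ) := by
      push_cast; linear_combination 4 * hquad
    have := im_eq_zero_of_sq_eq_ofReal (by positivity) hw
    simpa using this
  set t : ℝ := u.re with ht
  have hut : u = (t : ℂ) := by
    apply Complex.ext <;> simp [ht, huim]
  have htq : t ^ 2 + t - q = 0 := by
    have : ((t ^ 2 + t - q : ℝ) : ℂ) = 0 := by push_cast; rw [← hut]; exact hquad
    exact_mod_cast this
  -- `t > -3q`, hence `t² < 4q`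
  have ht3 : -3 * (q : ℝ) < t := by
    by_contra hle
    rw [not_lt] at hle
    have h1 : 3 * (q : ℝ) ≤ -t := by linarith
    have h2 : 3 * (q : ℝ) - 1 ≤ -(t + 1) := by linarith
    have hprod : 3 * (q : ℝ) * (3 * (q : ℝ) - 1) ≤ -t * (-(t + 1)) :=
      mul_le_mul h1 h2 (by linarith) (by linarith)
    nlinarith
  have ht4 : t ^ 2 < 4 * q := by nlinarith
  -- `α` and `ᾱ` are roots of `x² − t x + q`
  have hαq : α ^ 2 - (t : ℂ) * α + q = 0 := by rw [← hut]; linear_combination -hαu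
  have hβq : (starRingEnd ℂ α) ^ 2 - (t : ℂ) * starRingEnd ℂ α + q = 0 := by
    have := congrArg (starRingEnd ℂ) hαq
    simpa [map_sub, map_add, map_mul, map_pow, Complex.conj_ofReal] using this
  have hdiff : (α - starRingEnd ℂ α) * (α + starRingEnd ℂ α - t) = 0 := by
    linear_combination hαq - hβq
  have hsq : ‖α‖ ^ 2 = q := by
    rcases mul_eq_zero.1 hdiff with h0 | h0
    · -- `α` real: impossible since `t² < 4q`
      exfalso
      have hreal : α = (α.re : ℂ) := by
        have him : α.im = 0 := by
          have := congrArg Complex.im h0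
          simp [Complex.sub_im, Complex.conj_im] at this
          linarith
        apply Complex.ext <;> simp [him]
      set x : ℝ := α.re
      have hx : x ^ 2 - t * x + q = 0 := by
        have : ((x ^ 2 - t * x + q : ℝ) : ℂ) = 0 := by push_cast; rw [← hreal]; exact hαq
        exact_mod_cast this
      nlinarith [sq_nonneg (2 * x - t)]
    · -- `α + ᾱ = t`: then `α ᾱ = q`
      have hsum : starRingEnd ℂ α = (t : ℂ) - α := by linear_combination h0
      have hprod : α * starRingEnd ℂ α = q := by
        rw [hsum]; linear_combination -hαq
      have hn : ((Complex.normSq α : ℝ) : ℂ) = (q : ℂ) := by rw [← Complex.mul_conj, hprod]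
      have hn' : Complex.normSq α = q := by exact_mod_cast hn
      rw [← Complex.normSq_eq_norm_sq]; exact hn'
  have hnn : 0 ≤ ‖α‖ := norm_nonneg _
  rw [← Real.sqrt_sq hnn, hsq]

/-! ## 4. Door reading: a far-lag reader that certifies without deciding -/

/-- DECIDING ≠ MATCHING ABOVE THE HANDOVER (`g = 2`, the single lag `3 > g`, `q ≥ 1`).  The `{3}`-trace-local reader
`Φ(T) := [T_3(0,3) = K_thin(3)]` (i) depends only on the corner entry at lag `3`; (ii) accepts an honest datum of
dimension `2` (the thin quartic); (iii) IMPLIES RH at dimension `2`: every honest datum of dimension `2` it accepts is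
the thin quartic, hence RH-true; (iv) does NOT DECIDE RH at dimension `2`: it rejects the RH-true `x^4 + q^2`.
By part 7b (`traceReader_offLag_matched_by_rhFalse`) no reader of lags inside `[0, 2] ∖ {m}` has (ii) ∧ (iii).
[folklore] -/
theorem farLagReader_certifies {q : ℕ} (hq : 1 ≤ q) :
    ∃ Φ : Tower → Prop,
      (∀ T T' : Tower, (∀ n ∈ ({3} : Set ℕ), T n 0 (Fin.last n) = T' n 0 (Fin.last n)) → Φ T → Φ T') ∧
      (∃ h : ℤ[X], h.Monic ∧ h.natDegree = 2 * 2 ∧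
        (∀ i j, i + j = 2 * 2 → (q : ℤ) ^ 2 * h.coeff j = (q : ℤ) ^ i * h.coeff i) ∧
        Φ (weilWindowTower (q : ℝ) h)) ∧
      (∀ h : ℤ[X], h.Monic → h.natDegree = 2 * 2 →
        (∀ i j, i + j = 2 * 2 → (q : ℤ) ^ 2 * h.coeff j = (q : ℤ) ^ i * h.coeff i) →
        Φ (weilWindowTower (q : ℝ) h) → ∀ α ∈ frobRoots h, ‖α‖ = Real.sqrt q) ∧
      ¬ (∀ h : ℤ[X], h.Monic → h.natDegree = 2 * 2 →
        (∀ i j, i + j = 2 * 2 → (q : ℤ) ^ 2 * h.coeff j = (q : ℤ) ^ i * h.coeff i) →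
        (Φ (weilWindowTower (q : ℝ) h) ↔ ∀ α ∈ frobRoots h, ‖α‖ = Real.sqrt q)) := by
  have hq0 : 0 < q := hq
  have hqR : (0 : ℝ) < q := by exact_mod_cast hq0
  obtain ⟨hm, hd, hfe⟩ := thinQuartic_honest q
  refine ⟨fun T => T 3 0 (Fin.last 3) = weilWindowTower (q : ℝ) thinQ[q] 3 0 (Fin.last 3), ?_, ?_, ?_, ?_⟩
  · intro T T' hTT' hT
    rw [← hTT' 3 (by simp)]; exact hT
  · exact ⟨thinQ[q], hm, hd, hfe, rfl⟩
  · intro h hh hdeg hFE hΦ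
    have hs : powerSum (frobRoots h) 3 = -1 := by
      rw [← powerSum_three_thinQuartic hq0]
      exact (corner_eq_iff_powerSum_eq hqR h thinQ[q] 3).1 hΦ
    rw [eq_thinQuartic_of_powerSum_three hq0 hh hdeg hFE hs]
    exact ffRH_thinQuartic hq
  · intro hdec
    obtain ⟨hm', hd', hfe'⟩ :=
      Summit.RiemannHypothesis.RiemannHypothesis.Theorems.PfPersistence.FfAngleTwin.fe_X_pow_add_C q
        (g := 2) (by norm_num)
    have hacc : weilWindowTower (q : ℝ) (X ^ (2 * 2) + C ((q : ℤ) ^ 2) : ℤ[X]) 3 0 (Fin.last 3) =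
        weilWindowTower (q : ℝ) thinQ[q] 3 0 (Fin.last 3) :=
      (hdec _ hm' hd' hfe').2 (ffRH_X_pow_add_C q (g := 2) (by norm_num))
    have hs := (corner_eq_iff_powerSum_eq hqR _ thinQ[q] 3).1 hacc
    rw [powerSum_three_thinQuartic hq0, powerSum_three_of_dim_two hq0 hm' hd' hfe'] at hs
    have hc3 : (X ^ (2 * 2) + C ((q : ℤ) ^ 2) : ℤ[X]).coeff 3 = 0 := by
      simp only [coeff_add, coeff_X_pow, coeff_C]; norm_num
    rw [hc3] at hs
    norm_num at hs

/-- The same reader is NOT MATCHED by an honest fake: no honest RH-false datum of dimension `2` has `s_3 = -1`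
(`q ≥ 1`). [folklore] -/
theorem farLagReader_not_matched {q : ℕ} (hq : 1 ≤ q) {h : ℤ[X]} (hh : h.Monic) (hdeg : h.natDegree = 2 * 2)
    (hFE : ∀ i j, i + j = 2 * 2 → (q : ℤ) ^ 2 * h.coeff j = (q : ℤ) ^ i * h.coeff i)
    (hs : powerSum (frobRoots h) 3 = -1) : ∀ α ∈ frobRoots h, ‖α‖ = Real.sqrt q := by
  rw [eq_thinQuartic_of_powerSum_three hq hh hdeg hFE hs]
  exact ffRH_thinQuartic hq

end Summit.RiemannHypothesis.RiemannHypothesis.Theorems.MotivicDoor.FunctionField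

end
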